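import Summits.HodgeConjecture.CorCM.DistinctImaginaryQuadraticSexticCMHodge
import Summits.HodgeConjecture.CorCM.GenericSexticThreefoldPairsHodge
import Summits.HodgeConjecture.CorCM.GenericSexticThreefoldTimesCMHodge
import Literature.NumberTheory.ComplexMultiplication.SexticCMFieldQuadraticOrPairFlip
import HarnessLib

/-!
# The census of pairs of simple CM abelian THREEFOLDS: `Hg(T₀ × T₁) = Hg(T₀) × Hg(T₁)` and the Hodge conjecture on
# every `T₀^a × T₁^b` iff the two sextic CM fields share NO imaginary quadratic subfield; otherwise exceptional classes

COR-CM (cell `pub-hodgecm2`, binder seat `b16` gen 42, count-neutral claim CM33-QUADDISTINCT, file F5; theorems only, no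
definition, no named fact, no `sorry`).  NEW as stated, hence under `Summits/`.  ASSEMBLY of the census of two simple,
non-isogenous CM abelian threefolds `T₀ = A_{i₀}`, `T₁ = A_{i₁}` with sextic CM fields `K₀`, `K₁` (types `Φ_i`,
realisations on `H¹`), by the dichotomy «a sextic CM field has pair flips or contains an imaginary quadratic field»
(`Literature/NumberTheory/ComplexMultiplication/SexticCMFieldQuadraticOrPairFlip`):

* both fields with pair flips (Galois closures of degree `24`/`48`): nondegenerate —
  `GenericSexticThreefoldPairsHodge` (this seat, gen 41);
* one field with pair flips, the other through an imaginary quadratic field: nondegenerate —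
  `GenericSexticThreefoldTimesCMHodge` (gen 41);
* both through imaginary quadratic fields `k₀ ≄ k₁`: nondegenerate — `DistinctImaginaryQuadraticSexticCMHodge` (gen 42);
* both through ONE imaginary quadratic field: degenerate, exceptional Hodge classes on some product —
  `SharedImaginaryQuadraticCMFieldsHodge` (b23).

RESULTS (a "common imaginary quadratic subfield" is an `F ≤ K₀` with `[F:ℚ] = 2`, `F` totally complex, `Hom(F, K₁) ≠ ∅`):

* `not_pairFlip_of_quadratic` — the dichotomy is exclusive: a sextic CM field through an imaginary quadratic field
  has no pair flip;
* **`isNondegenerateFamily_simpleThreefolds_iff`** — `(Φ₀, Φ₁)` is nondegenerate (`Hg(T₀ × T₁) = Hg(T₀) × Hg(T₁)`)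
  iff `K₀`, `K₁` have no common imaginary quadratic subfield;
* **`hodgeConjectureFor_prod_simpleThreefolds`** — in that case the Hodge conjecture and `B• = D•` hold on every
  `⨁_{j<N} T_{π j}`, UNCONDITIONALLY; `forall_prod_hodgeClassSpan_eq_simpleThreefolds_iff`;
* **`exists_exceptional_prod_simpleThreefolds_iff`** — some `T₀^a × T₁^b` carries an exceptional Hodge class iff
  `K₀`, `K₁` DO share an imaginary quadratic subfield (these classes are NOT claimed algebraic or non-algebraic; for
  non-Galois `K₀ ≠ K₁` they are algebraic modulo Markman, b30's `TwoSexticFieldsThreefoldPairHodgeOfMarkman`);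
* `hodgeConjectureFor_prod_or_exists_exceptional_simpleThreefolds` — the packaged dichotomy.

HC_CM is NOT proved and not touched; these are statements about NAMED classes of CM abelian varieties.

## References

* [Gordon1999HodgeAVSurvey] B. B. Gordon, *A survey of the Hodge conjecture for abelian varieties*, §3 Theorem, 7.4–7.7,
  9.4, 10.10; Ribet's bound (3.7).
* [MoonenZarhin1999LowDim] B. Moonen, Yu. Zarhin, *Hodge classes on abelian varieties of low dimension*, Math. Ann. 315
  (1999), §§1–2.
* [Dodson1984] B. Dodson, Trans. AMS 283 (1984), §5.1.2 Theorem (`n = 3`).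
* [Shimura1998] G. Shimura, *Abelian Varieties with Complex Multiplication and Modular Functions*, §8.4, §18.1.
-/

noncomputable section

open CategoryTheory CategoryTheory.Limits NumberField NumberField.ComplexEmbedding Module

namespace Summit.HodgeConjecture.CorCM

open Literature.NumberTheory.ComplexMultiplication
open Literature.AlgebraicGeometry.Motives (AbelianVariety CMType)
open Literature.AlgebraicGeometry.HodgeTheory
open Literature.AlgebraicGeometry.ComplexMultiplication (IsCMTypeRealisation)
open Literature.AlgebraicGeometry.VanGeemen1994 (hodgeClassSpan)
open Literature.AlgebraicGeometry.Pohlmann1968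
open Literature.Barriers.HodgeConjecture (divisorClassesSpan)

/-! ## §1 The dichotomy is exclusive -/

section Exclusive

variable {k L : Type} [Field k] [NumberField k] [IsTotallyComplex k] [Field L] [NumberField L]

open scoped Classical in
/-- **A sextic CM field through an imaginary quadratic field has no pair flip**: a flip at `s` would fix the two other
embeddings over `ψ = s|_k` (the fibre of `ψ` has three elements) hence fix `ψ`, yet it maps `s` to `s̄`, which lies over
`ψ̄ ≠ ψ`. [cite: Shimura1998, §18.1] [cite: Dodson1984, §5.1.2 Theorem] -/
theorem not_pairFlip_of_quadratic (h2 : finrank ℚ k = 2) (h6 : finrank ℚ L = 6) (e : k →+* L) (s : L →+* ℂ) :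
    ¬ ∃ σ : ℂ ≃+* ℂ, σ • s = (starRingAut : ℂ ≃+* ℂ) • s ∧
      ∀ t : L →+* ℂ, t ≠ s → t ≠ (starRingAut : ℂ ≃+* ℂ) • s → σ • t = t := by
  rintro ⟨σ, hσs, hσt⟩
  -- a second embedding `t ≠ s` over `ψ = s ∘ e`
  have h3 := WeilFibre.card_fibre_eq_three (CMTypeCount.stdCMType (K := k)) h2 h6 e (s.comp e)
  obtain ⟨t, ht, hts⟩ : ∃ t ∈ (Finset.univ.filter fun t : L →+* ℂ => t.comp e = s.comp e), t ≠ s :=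
    Finset.exists_mem_ne (by rw [h3]; norm_num) s
  simp only [Finset.mem_filter, Finset.mem_univ, true_and] at ht
  -- `t ≠ s̄` since `s̄` lies over `ψ̄ ≠ ψ`
  have htbar : t ≠ (starRingAut : ℂ ≃+* ℂ) • s := fun h => by
    have h' : t.comp e = conjugate (s.comp e) := by
      rw [h, conj_smul_eq_conjugate, WeilFibre.conjugate_comp]
    rw [ht] at h'
    exact CMTypeCount.conjugate_ne_self (s.comp e) h'.symm
  -- `σ` fixes `t`, hence `ψ`; but `σ s = s̄` lies over `ψ̄`
  have hfix : σ • s.comp e = s.comp e := by rw [← ht, ← WeilFibre.smul_comp, hσt t hts htbar]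
  have hmove : σ • s.comp e = conjugate (s.comp e) := by
    rw [← WeilFibre.smul_comp, hσs, conj_smul_eq_conjugate, WeilFibre.conjugate_comp]
  exact CMTypeCount.conjugate_ne_self (s.comp e) (hmove.symm.trans hfix)

end Exclusive

/-! ## §2 The census -/

section Census

variable {I : Type} {K : I → Type} [∀ i, Field (K i)] [∀ i, NumberField (K i)] [∀ i, IsCMField (K i)] [Fintype I]
  [DecidableEq I] [Nonempty I] {Φ : ∀ i, CMType (K i)}
variable {A : I → AbelianVariety ℂ} {ι : ∀ i, 𝓞 (K i) →+* End (A i)}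
  {θ : ∀ i, K i →+* Module.End ℂ (complexBetti (A i).X 1)}

/-- **The census of pairs of simple CM threefolds, types level.**  For two SIMPLE, NON-ISOGENOUS CM abelian threefolds
with sextic CM fields `K_{i₀}`, `K_{i₁}`: the pair of their types is nondegenerate (`Hg(T₀ × T₁) = Hg(T₀) × Hg(T₁)`) iff
NO imaginary quadratic subfield of `K_{i₀}` embeds in `K_{i₁}`.
[cite: Gordon1999HodgeAVSurvey, §3 Theorem, 7.4–7.7 and 9.4] [cite: Dodson1984, §5.1.2 Theorem] -/
theorem isNondegenerateFamily_simpleThreefolds_iff {i₀ i₁ : I} (h01 : i₀ ≠ i₁) (hI : ∀ j, j = i₀ ∨ j = i₁)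
    (h6 : ∀ i, finrank ℚ (K i) = 6) (hA : ∀ i, IsCMTypeRealisation (Φ i) (A i) (ι i) (θ i))
    (hS : ∀ i, (A i).IsSimple) (hniso : ∀ i j, i ≠ j → ¬ AbelianVariety.IsIsogenous (A i) (A j)) :
    CMAlgebra.IsNondegenerateFamily Φ ↔
      ¬ ∃ F : IntermediateField ℚ (K i₀), finrank ℚ F = 2 ∧ IsTotallyComplex F ∧ Nonempty (F →+* K i₁) := by
  constructor
  · -- a common imaginary quadratic subfield forces degeneracy (b23)
    rintro hnd ⟨F, hF2, hFtc, ⟨j₁⟩⟩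
    haveI := hFtc
    exact not_isNondegenerateFamily_of_shared_imaginary_quadratic (k := ↥F) hF2 h01 (algebraMap (↥F) (K i₀)) j₁ Φ hnd
  · intro hno
    have hI' : ∀ j, j = i₁ ∨ j = i₀ := fun j => (hI j).symm
    rcases pairFlip_or_exists_imaginary_quadratic (K := K i₀) (h6 i₀) with hflip₀ | ⟨F₀, hF₀2, hF₀tc⟩ <;>
      rcases pairFlip_or_exists_imaginary_quadratic (K := K i₁) (h6 i₁) with hflip₁ | ⟨F₁, hF₁2, hF₁tc⟩
    · -- both fields have pair flips (gen 41, `GenericSexticThreefoldPairsHodge`)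
      refine isNondegenerateFamily_pairFlipSextic_pair_of_not_isIsogenous h01 hI (fun i => ?_) h6 hA hniso
      rcases hI i with rfl | rfl
      · exact hflip₀
      · exact hflip₁
    · -- `K_{i₀}` has pair flips, `K_{i₁} ⊇ F₁` (gen 41, `GenericSexticThreefoldTimesCMHodge`, roles swapped)
      haveI := hF₁tc
      exact isNondegenerateFamily_pairFlipSextic_simpleThreefold_of_quadratic (k := ↥F₁) h01.symm hI' hflip₀ h6 hF₁2
        (algebraMap (↥F₁) (K i₁)) hA (hS i₁)
    · -- `K_{i₀} ⊇ F₀`, `K_{i₁}` has pair flips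
      haveI := hF₀tc
      exact isNondegenerateFamily_pairFlipSextic_simpleThreefold_of_quadratic (k := ↥F₀) h01 hI hflip₁ h6 hF₀2
        (algebraMap (↥F₀) (K i₀)) hA (hS i₀)
    · -- both through imaginary quadratic fields: they are non-isomorphic by `hno` (gen 42)
      haveI := hF₀tc
      haveI := hF₁tc
      have hk : IsEmpty (↥F₀ →+* ↥F₁) := ⟨fun f => hno ⟨F₀, hF₀2, hF₀tc, ⟨(algebraMap (↥F₁) (K i₁)).comp f⟩⟩⟩
      exact isNondegenerateFamily_sexticThreefolds_of_isEmpty_quadratic_ringHom h01 hI hF₀2 hF₁2 h6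
        (algebraMap (↥F₀) (K i₀)) (algebraMap (↥F₁) (K i₁)) hk hA hS

/-- **The Hodge conjecture and `B• = D•` on every `T₀^a × T₁^b`** (every `⨁_{j<N} T_{π j}`) of two simple, non-isogenous
CM abelian threefolds whose sextic CM fields share no imaginary quadratic subfield — UNCONDITIONALLY.  This covers
every pair of simple CM threefolds except those through ONE imaginary quadratic field.
[cite: Gordon1999HodgeAVSurvey, §3 Theorem and 10.10] [cite: Dodson1984, §5.1.2 Theorem] -/
theorem hodgeConjectureFor_prod_simpleThreefolds {i₀ i₁ : I} (h01 : i₀ ≠ i₁) (hI : ∀ j, j = i₀ ∨ j = i₁)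
    (h6 : ∀ i, finrank ℚ (K i) = 6) (hA : ∀ i, IsCMTypeRealisation (Φ i) (A i) (ι i) (θ i))
    (hS : ∀ i, (A i).IsSimple) (hniso : ∀ i j, i ≠ j → ¬ AbelianVariety.IsIsogenous (A i) (A j))
    (hno : ¬ ∃ F : IntermediateField ℚ (K i₀), finrank ℚ F = 2 ∧ IsTotallyComplex F ∧ Nonempty (F →+* K i₁))
    {N : ℕ} (π : Fin N → I) :
    HodgeConjectureFor (⨁ fun j : Fin N => A (π j)).dim (⨁ fun j : Fin N => A (π j)).X ∧
      ∀ m : ℕ, hodgeClassSpan (⨁ fun j : Fin N => A (π j)).dim (⨁ fun j : Fin N => A (π j)).X m =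
        divisorClassesSpan (⨁ fun j : Fin N => A (π j)).X (⨁ fun j : Fin N => A (π j)).dim m :=
  have h := (isNondegenerateFamily_simpleThreefolds_iff h01 hI h6 hA hS hniso).2 hno
  ⟨h.hodgeConjectureFor_prod hA π, fun m => h.hodgeClassSpan_prod_eq_divisorClassesSpan hA π m⟩

/-- **`B• = D•` on every `T₀^a × T₁^b` iff the sextic CM fields share no imaginary quadratic subfield** (two simple,
non-isogenous CM threefolds). [cite: Gordon1999HodgeAVSurvey, §3 Theorem, 7.5–7.7 and 9.4] -/
theorem forall_prod_hodgeClassSpan_eq_simpleThreefolds_iff {i₀ i₁ : I} (h01 : i₀ ≠ i₁) (hI : ∀ j, j = i₀ ∨ j = i₁)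
    (h6 : ∀ i, finrank ℚ (K i) = 6) (hA : ∀ i, IsCMTypeRealisation (Φ i) (A i) (ι i) (θ i))
    (hS : ∀ i, (A i).IsSimple) (hniso : ∀ i j, i ≠ j → ¬ AbelianVariety.IsIsogenous (A i) (A j)) :
    (∀ (N : ℕ) (π : Fin N → I) (m : ℕ),
        hodgeClassSpan (⨁ fun j : Fin N => A (π j)).dim (⨁ fun j : Fin N => A (π j)).X m =
          divisorClassesSpan (⨁ fun j : Fin N => A (π j)).X (⨁ fun j : Fin N => A (π j)).dim m) ↔
      ¬ ∃ F : IntermediateField ℚ (K i₀), finrank ℚ F = 2 ∧ IsTotallyComplex F ∧ Nonempty (F →+* K i₁) :=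
  (CMAlgebra.isNondegenerateFamily_iff_forall_prod_hodgeClassSpan_eq
      (CMAlgebra.isSeparatingFamily_of_isSimple_of_pairwise_not_isIsogenous hA hS hniso) hA).symm.trans
    (isNondegenerateFamily_simpleThreefolds_iff h01 hI h6 hA hS hniso)

/-- **An exceptional Hodge class on some `T₀^a × T₁^b` iff the sextic CM fields SHARE an imaginary quadratic subfield**
(two simple, non-isogenous CM threefolds; the classes are not claimed algebraic or non-algebraic here).
[cite: Gordon1999HodgeAVSurvey, 7.5–7.7 and 9.4] [cite: MoonenZarhin1999LowDim, §§1–2] -/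
theorem exists_exceptional_prod_simpleThreefolds_iff {i₀ i₁ : I} (h01 : i₀ ≠ i₁) (hI : ∀ j, j = i₀ ∨ j = i₁)
    (h6 : ∀ i, finrank ℚ (K i) = 6) (hA : ∀ i, IsCMTypeRealisation (Φ i) (A i) (ι i) (θ i))
    (hS : ∀ i, (A i).IsSimple) (hniso : ∀ i j, i ≠ j → ¬ AbelianVariety.IsIsogenous (A i) (A j)) :
    (∃ (N : ℕ) (π : Fin N → I) (m : ℕ) (c : complexBetti (⨁ fun j : Fin N => A (π j)).X (2 * m)),
        IsRationalClass c ∧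
        IsOfHodgeType (⨁ fun j : Fin N => A (π j)).dim (⨁ fun j : Fin N => A (π j)).X (2 * m) m m c ∧
        c ∉ divisorClassesSpan (⨁ fun j : Fin N => A (π j)).X (⨁ fun j : Fin N => A (π j)).dim m) ↔
      ∃ F : IntermediateField ℚ (K i₀), finrank ℚ F = 2 ∧ IsTotallyComplex F ∧ Nonempty (F →+* K i₁) := by
  have hsep := CMAlgebra.isSeparatingFamily_of_isSimple_of_pairwise_not_isIsogenous hA hS hniso
  constructor
  · rintro ⟨N, π, m, c, hc, hpq, hnot⟩
    by_contra hno
    exact ((isNondegenerateFamily_simpleThreefolds_iff h01 hI h6 hA hS hniso).2 hno).not_exists_exceptional_prod hA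
      π m ⟨c, hc, hpq, hnot⟩
  · intro hF
    exact CMAlgebra.exists_exceptional_prod_of_not_isNondegenerateFamily hsep
      (fun hnd => (isNondegenerateFamily_simpleThreefolds_iff h01 hI h6 hA hS hniso).1 hnd hF) hA

/-- **The dichotomy for two simple, non-isogenous CM abelian threefolds**, packaged: EITHER their sextic CM fields share
no imaginary quadratic subfield and the Hodge conjecture (with `B• = D•`) holds on every `T₀^a × T₁^b`, OR they share one
and some `T₀^a × T₁^b` carries an exceptional Hodge class. [cite: Gordon1999HodgeAVSurvey, 7.5–7.7 and 10.10] -/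
theorem hodgeConjectureFor_prod_or_exists_exceptional_simpleThreefolds {i₀ i₁ : I} (h01 : i₀ ≠ i₁)
    (hI : ∀ j, j = i₀ ∨ j = i₁) (h6 : ∀ i, finrank ℚ (K i) = 6)
    (hA : ∀ i, IsCMTypeRealisation (Φ i) (A i) (ι i) (θ i)) (hS : ∀ i, (A i).IsSimple)
    (hniso : ∀ i j, i ≠ j → ¬ AbelianVariety.IsIsogenous (A i) (A j)) :
    ((¬ ∃ F : IntermediateField ℚ (K i₀), finrank ℚ F = 2 ∧ IsTotallyComplex F ∧ Nonempty (F →+* K i₁)) ∧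
        ∀ (N : ℕ) (π : Fin N → I),
          HodgeConjectureFor (⨁ fun j : Fin N => A (π j)).dim (⨁ fun j : Fin N => A (π j)).X ∧
            ∀ m : ℕ, hodgeClassSpan (⨁ fun j : Fin N => A (π j)).dim (⨁ fun j : Fin N => A (π j)).X m =
              divisorClassesSpan (⨁ fun j : Fin N => A (π j)).X (⨁ fun j : Fin N => A (π j)).dim m) ∨
      ((∃ F : IntermediateField ℚ (K i₀), finrank ℚ F = 2 ∧ IsTotallyComplex F ∧ Nonempty (F →+* K i₁)) ∧
        ∃ (N : ℕ) (π : Fin N → I) (m : ℕ) (c : complexBetti (⨁ fun j : Fin N => A (π j)).X (2 * m)),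
          IsRationalClass c ∧
          IsOfHodgeType (⨁ fun j : Fin N => A (π j)).dim (⨁ fun j : Fin N => A (π j)).X (2 * m) m m c ∧
          c ∉ divisorClassesSpan (⨁ fun j : Fin N => A (π j)).X (⨁ fun j : Fin N => A (π j)).dim m) := by
  by_cases hF : ∃ F : IntermediateField ℚ (K i₀), finrank ℚ F = 2 ∧ IsTotallyComplex F ∧ Nonempty (F →+* K i₁)
  · exact Or.inr ⟨hF, (exists_exceptional_prod_simpleThreefolds_iff h01 hI h6 hA hS hniso).2 hF⟩
  · exact Or.inl ⟨hF, fun N π => hodgeConjectureFor_prod_simpleThreefolds h01 hI h6 hA hS hniso hF π⟩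

end Census

end Summit.HodgeConjecture.CorCM

end
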